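import Summits.AnomalousDissipation.AnomalousDissipation.Theorems.SolenoidalFractalHomogenisationLagrangianStepOneLevelGlue
import Summits.AnomalousDissipation.AnomalousDissipation.Theorems.SolenoidalFractalHomogenisationRealisedQuasiStaticCellLawCellUnique
import Summits.AnomalousDissipation.AnomalousDissipation.Theorems.SolenoidalFractalHomogenisationRealisedQuasiStaticCellLawSectorReduction
import Literature.Analysis.FluidPDE.PassiveVectorTensorEnergyDecay
import HarnessLib

/-!
# K1L `LagrangianRenormalisationStep` (stmt-AnomalousDissipation-24912) — finding F-p4g7-4: the ENERGY sub-conjunct of the fluctuation clause (F)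
# inside `stub_cellEnergyT` is the Literature's tensor energy inequality

Planner `ad-ideate-p4` g7, 2026-08-28.  Sorry-free.  Companion of F-p4g7-2 and F-p4g7-3.

`stub_cellEnergyT` (L) concludes `∃ C ≥ 0, ∃ ν₀ > 0, ∃ K > 0, CellEnergyClauses W M hM c lo hi Λ β C ν₀ K`, whose clause (F) asserts for every
weak solution `u` of the cell problem (tensor `(1/n²)•𝔸`, carrier `cellField W M hM ν _ n`, class datum `F` without modes below `n/2`)
`∀ᵐ t, ∫‖u t‖² ≤ ∫‖F‖² ∧ lowEnergy L (u t) ≤ C·(cL²/(n²ν²))·∫‖F‖²`.  The FIRST conjunct is the energy inequality of EVERY weak solution of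
the passive solenoidal vector equation with a coercive constant tensor and a bounded carrier — in the Literature as
`Torus.IsWeakTensorPassiveVectorOn.ae_energy_ineq` (PassiveVectorTensorEnergyDecay.lean: `ofReal ∫‖w t‖² + 2·eVectorDissipation ≤ ofReal ∫‖w₀‖²`,
[Temam1984, Ch. III §1 Lemma 1.2]) — its hypotheses are supplied by the window (`NearIso ((1/n²)•𝔸)` with lower constant `(1/n²)·ν·lo/λ > 0`,
`n ≥ 1` forced by `L > 0 ∧ L⌈K/ν⌉ ≤ n`), by `IsDatum F` (`H¹ ⊂ L²` via K2R's `memLp_two_of_memSobolev_one_complexify`, weak divergence-freeness)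
and by K2R's `memLp_top_stLift_cell` (the cell carrier is bounded and jointly continuous; `cellField` IS a `LatticeWord.cell`).  Hence:

* `CellEnergyClausesNoE` — `CellEnergyClauses` VERBATIM with `∫ x, ‖u t x‖ ^ 2 ≤ ∫ x, ‖F x‖ ^ 2 ∧` deleted;
* `ae_energy_le_datum` — the deleted conjunct, for every weak cell solution;
* `cellEnergyClauses_of_noE : 0 < lo → 0 < K → CellEnergyClausesNoE … → CellEnergyClauses …`;
* `cellEnergyT_of_cellEnergyTNoE` — ADAPTER: the proposed v21 statement of `stub_cellEnergyT` (conclusion `CellEnergyClausesNoE`) implies the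
  registered one; composition change = one token.
-/

set_option linter.dupNamespace false
set_option linter.unusedVariables false

namespace Summit.AnomalousDissipation.AnomalousDissipation.Cruxes.LagrangianRenormalisationStep.CellEnergyTNoE

open Set Filter MeasureTheory Function
open scoped ENNReal NNReal InnerProductSpace
open Literature.Analysis Literature.Analysis.FunctionSpaces Literature.Analysis.FunctionSpaces.Torus
open Literature.Analysis.FluidPDE Literature.Analysis.FluidPDE.LatticeShear
open Summit.AnomalousDissipation.AnomalousDissipation.Theorems.SolenoidalFractalHomogenisation.RealisedQuasiStaticCellLaw
  (memLp_two_of_memSobolev_one_complexify memLp_top_stLift_cell)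
open Summit.AnomalousDissipation.AnomalousDissipation.Theorems.SolenoidalFractalHomogenisation.LagrangianStep

noncomputable section

/-- The CELL-ENERGY clauses WITHOUT the energy-inequality conjunct of (F) (`CellEnergyClauses` verbatim otherwise). -/
def CellEnergyClausesNoE {k : ℕ} (W : LatticeShear.LatticeWord k) (M : ℝ) (hM : 0 < M) (c : ℝ) (lo hi Λ β C ν₀ K : ℝ) : Prop :=
      ∀ ν, ∀ hν : ν ∈ Set.Ioo 0 ν₀, ∀ n : ℕ, ∀ 𝔸 : Torus.Visc4 (Fin 3),
        Torus.OddSmall 𝔸 (ν * β) → (∃ lam ∈ Set.Icc (1:ℝ) Λ, Torus.NearIso 𝔸 (ν * (lo / lam)) (ν * (hi * lam))) →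
        (∀ L > (0:ℝ), L * (⌈K / ν⌉₊ : ℝ) ≤ n → ∀ F : VF, IsDatum F →
            (∀ k' : Fin 3 → ℤ, ‖Torus.latticeVec k'‖ < (n:ℝ) / 2 → ∀ i, modeCoeff k' F i = 0) →
            ∀ T > (0:ℝ), ∀ u : ℝ → VF, Torus.IsWeakTensorPassiveVectorOn 0 T ((1 / (n:ℝ) ^ 2) • 𝔸) (cellField W M hM ν hν.1 n) F u →
              ∀ᵐ t ∂(volume.restrict (Ioo 0 T)),
                lowEnergy L (u t) ≤ C * (c * L ^ 2 / ((n:ℝ) ^ 2 * ν ^ 2)) * ∫ x, ‖F x‖ ^ 2) ∧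
        ∀ ℓ : Fin 3 → ℤ, ℓ ≠ 0 → ‖Torus.latticeVec ℓ‖ * (⌈K / ν⌉₊ : ℝ) ≤ n →
        ∀ p : EuclideanSpace ℝ (Fin 3), ‖p‖ = 1 → ⟪p, Torus.latticeVec ℓ⟫_ℝ = 0 →
        ∀ T > (0:ℝ), ∀ w : ℝ → VF,
            Torus.IsWeakTensorPassiveVectorOn 0 T ((1 / (n:ℝ) ^ 2) • 𝔸) (cellField W M hM ν hν.1 n) (fun x => (UnitAddTorus.mFourier ℓ x).re • p) w →
            ∀ᵐ t ∂(volume.restrict (Ioo 0 T)),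
              ∫ x, ‖w t x‖ ^ 2 - lowEnergy ((n:ℝ) / 2) (w t)
                  ≤ C * (c * ‖Torus.latticeVec ℓ‖ ^ 2 / ((n:ℝ) ^ 2 * ν ^ 2)) * ∫ x, ‖(UnitAddTorus.mFourier ℓ x).re • p‖ ^ 2

/-- **Energy inequality for every weak cell solution** (the deleted conjunct): window ellipticity + bounded continuous cell carrier + `L²`
divergence-free datum ⇒ `∫‖u t‖² ≤ ∫‖F‖²` for a.e. `t ∈ (0,T)`. [cite: Temam1984, Ch. III §1 Lemma 1.2] -/
theorem ae_energy_le_datum {k : ℕ} {W : LatticeWord k} {M : ℝ} {hM : 0 < M} {lo hi Λ : ℝ} (hlo : 0 < lo)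
    {ν : ℝ} (hν : 0 < ν) {n : ℕ} (hn : 1 ≤ (n:ℝ)) {𝔸 : FluidPDE.Torus.Visc4 (Fin 3)}
    (hwin' : ∃ lam ∈ Set.Icc (1:ℝ) Λ, FluidPDE.Torus.NearIso 𝔸 (ν * (lo / lam)) (ν * (hi * lam)))
    {F : VF} (hF : IsDatum F) {T : ℝ} {u : ℝ → VF}
    (hu : FluidPDE.Torus.IsWeakTensorPassiveVectorOn 0 T ((1 / (n:ℝ) ^ 2) • 𝔸) (cellField W M hM ν hν n) F u) :
    ∀ᵐ t ∂(volume.restrict (Ioo 0 T)), ∫ x, ‖u t x‖ ^ 2 ≤ ∫ x, ‖F x‖ ^ 2 := by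
  obtain ⟨lam, hlam, hA⟩ := hwin'
  have hlam1 : 0 < lam := lt_of_lt_of_le one_pos hlam.1
  have hN : FluidPDE.Torus.NearIso ((1 / (n:ℝ) ^ 2) • 𝔸) ((1 / (n:ℝ) ^ 2) * (ν * (lo / lam))) ((1 / (n:ℝ) ^ 2) * (ν * (hi * lam))) :=
    hA.smul (by positivity)
  have hlo' : 0 < (1 / (n:ℝ) ^ 2) * (ν * (lo / lam)) := by positivity
  have hb : MemLp (stLift (cellField W M hM ν hν n)) ∞ (volume.restrict (Ioo 0 T ×ˢ (univ : Set (EuclideanSpace ℝ (Fin 3))))) := by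
    unfold cellField
    exact memLp_top_stLift_cell _ n T
  have h := hu.ae_energy_ineq hN hlo' (memLp_two_of_memSobolev_one_complexify hF.1) hF.2.2 hb
  filter_upwards [h] with t ht
  have h1 : ENNReal.ofReal (∫ x, ‖u t x‖ ^ 2) ≤ ENNReal.ofReal (∫ x, ‖F x‖ ^ 2) := le_trans le_self_add ht
  exact (ENNReal.ofReal_le_ofReal_iff (integral_nonneg fun _ => by positivity)).1 h1

/-- `L > 0` and `L·⌈K/ν⌉ ≤ n` (`K, ν > 0`) force `1 ≤ n`. -/
theorem one_le_of_band {L K ν : ℝ} (hL : 0 < L) (hK : 0 < K) (hν : 0 < ν) {n : ℕ} (h : L * (⌈K / ν⌉₊ : ℝ) ≤ n) : 1 ≤ (n:ℝ) := by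
  have h1 : (1:ℝ) ≤ ⌈K / ν⌉₊ := by exact_mod_cast Nat.one_le_iff_ne_zero.mpr (Nat.pos_iff_ne_zero.mp (Nat.ceil_pos.mpr (div_pos hK hν)))
  have h2 : 0 < L * (⌈K / ν⌉₊ : ℝ) := by positivity
  have h3 : (0:ℝ) < n := lt_of_lt_of_le h2 h
  exact_mod_cast Nat.one_le_iff_ne_zero.mpr (by rintro rfl; simp at h3)

/-- **(C)+(F) without the energy conjunct ⇒ (C)+(F).** -/
theorem cellEnergyClauses_of_noE {k : ℕ} {W : LatticeWord k} {M : ℝ} {hM : 0 < M} {c : ℝ} {lo hi Λ β C ν₀ K : ℝ}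
    (hlo : 0 < lo) (hK : 0 < K) (h : CellEnergyClausesNoE W M hM c lo hi Λ β C ν₀ K) : CellEnergyClauses W M hM c lo hi Λ β C ν₀ K := by
  intro ν hν n 𝔸 hodd hwin'
  obtain ⟨hFcl, hCcl⟩ := h ν hν n 𝔸 hodd hwin'
  refine ⟨fun L hL hLn F hF hmodes T hT u hu => ?_, hCcl⟩
  have h1 := ae_energy_le_datum (hM := hM) hlo hν.1 (one_le_of_band hL hK hν.1 hLn) hwin' hF hu
  have h2 := hFcl L hL hLn F hF hmodes T hT u hu
  filter_upwards [h1, h2] with t ht1 ht2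
  exact ⟨ht1, ht2⟩

/-- **ADAPTER v21 → registered.**  The proposed statement of `stub_cellEnergyT` (conclusion `CellEnergyClausesNoE`) implies the registered one. -/
theorem cellEnergyT_of_cellEnergyTNoE
    (hT : ∀ k (W : Literature.Analysis.FluidPDE.LatticeShear.LatticeWord k) (M : ℝ) (hM : 0 < M) (c : ℝ), 0 < c →
    ∀ lo hi Λ β : ℝ, 0 < lo → lo ≤ 1 → 1 ≤ hi → 1 < Λ → 0 ≤ β →
      ∃ C : ℝ, 0 ≤ C ∧ ∃ ν₀ > (0:ℝ), ∃ K > (0:ℝ), CellEnergyClausesNoE W M hM c lo hi Λ β C ν₀ K) :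
    ∀ k (W : Literature.Analysis.FluidPDE.LatticeShear.LatticeWord k) (M : ℝ) (hM : 0 < M) (c : ℝ), 0 < c →
    ∀ lo hi Λ β : ℝ, 0 < lo → lo ≤ 1 → 1 ≤ hi → 1 < Λ → 0 ≤ β →
      ∃ C : ℝ, 0 ≤ C ∧ ∃ ν₀ > (0:ℝ), ∃ K > (0:ℝ), CellEnergyClauses W M hM c lo hi Λ β C ν₀ K := by
  intro k W M hM c hc lo hi Λ β hlo hlo1 hhi1 hΛ hβ
  obtain ⟨C, hC, ν₀, hν₀, K, hK, h⟩ := hT k W M hM c hc lo hi Λ β hlo hlo1 hhi1 hΛ hβ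
  exact ⟨C, hC, ν₀, hν₀, K, hK, cellEnergyClauses_of_noE hlo hK h⟩

end

end Summit.AnomalousDissipation.AnomalousDissipation.Cruxes.LagrangianRenormalisationStep.CellEnergyTNoE
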